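import Mathlib.Analysis.SpecialFunctions.Log.Deriv
import Mathlib.Analysis.SpecialFunctions.Pow.Real
import Mathlib.Analysis.Calculus.MeanValue
import Mathlib.Analysis.Calculus.Deriv.MeanValue
import Mathlib.Algebra.Order.Chebyshev
import Summits.CriticalPhenomena.PercolationContinuityZ3.Theorems.PercNearOneGluingNoHeavyLowerTailMajorityGluingHubRefreshIsoFiveLineCore
import HarnessLib

/-!
# The analytic core of the m-POINT ISOLATION INEQUALITY (ISO_m) along one marked–Steiner line (lane prim-rate, constants-miner 1, gen 31; CANDIDATES §GEN-16 R125–R130, §GEN-31)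

Support file for the closed crux `NoHeavyLowerTail` (stmt-CriticalPhenomena-4575), majority-gluing line.  THEOREM E of the lane
(`prim-rate-mine-1/K1-PROOF.md`, kernel files `…MajorityGluingHubRefreshIsoFive*`) is the five-point case `μ(⊥)^{5/2} ≤ ∏_t μ(Iso_t)`
of the **m-point isolation inequality** (CANDIDATES §GEN-16 R130, hitherto a paper theorem): for every finite weighted graph and every
`m ≥ 2` marked points, `μ(all m pairwise separated)^{γ} ≤ ∏_t μ(t joined to no other marked point)` for every exponent `γ ≥ 2` with
`K γ ≥ K + 1` and `K γ² − 3 K γ + K + 1 ≥ 0`, `K = m − 1` — in particular for the method's sharp constant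
`γ = c*_m = (3 + √(5 − 4/(m−1)))/2` (`c*_3 = (3+√3)/2 = 2.366…`, `c*_4 = (3+√(11/3))/2 = 2.457…`, `c*_5 = 5/2`), the exponents of the
ISO₃ / ISO₄ / ISO₅ rows of the lane's abstract `(4,3)` programme (`HubOnly.TypeTable.SymLaw.isoH/isoR/iso4/isoH4/iso5`).

THIS FILE is the m-point version of `…MajorityGluingHubRefreshIsoFiveLineCore` (same proof, index type `ι` instead of `Fin 5`, a
distinguished index `i₀` instead of `0`, exponent `γ` instead of `5/2`): along the weight `w` of ONE marked–Steiner edge at the marked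
point `i₀`, `u(w) = A − w·B` and `r_t(w) = a_t − w·b_t` are affine, the van den Berg–Häggström–Kahn bound reads
`Σ_{t ≠ i₀} b_t/(a_t − w b_t) ≤ B/(A − w B)` (`hσ`), and under it the deficit `F(w) = Σ_t log(a_t − w b_t) − γ·log(A − w B)` is
unimodal on `[0,1]` (`F_ge_min`), so `(ISO_m)` at the two end points implies `(ISO_m)` on the whole line (`iso_line`, stated with
`Real.rpow`).  The key step is the quadratic lemma `quad_gen` («why `c*_m`»: Cauchy–Schwarz over the `K = m − 1` non-`i₀` points meets
the exponent `γ` exactly when `K γ² − 3 K γ + K + 1 ≥ 0`).  No percolation here; no sorries, no definitions, no named facts.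
[cite: Grimmett1999, §2.2]
-/

noncomputable section

namespace Summit.CriticalPhenomena.PercolationContinuityZ3.Theorems

namespace HubOnly
namespace Refresh
namespace IsoPtsLine

open Real Finset Set

variable {ι : Type} [Fintype ι] [DecidableEq ι]

/-! ### The quadratic lemma for `m = K + 1` points -/

/-- Splitting a sum over `ι` at the distinguished index. [folklore] -/
theorem sum_split (f : ι → ℝ) (i₀ : ι) : ∑ t, f t = f i₀ + ∑ t ∈ univ.erase i₀, f t :=
  (Finset.add_sum_erase _ f (mem_univ i₀)).symm

/-- The number of non-distinguished indices as a real number: `#(univ.erase i₀) = K` when `#ι = K + 1`. [folklore] -/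
theorem card_erase_eq {K : ℝ} (hK : (Fintype.card ι : ℝ) = K + 1) (i₀ : ι) : ((univ.erase i₀).card : ℝ) = K := by
  have h := Finset.card_erase_add_one (mem_univ i₀)
  rw [Finset.card_univ] at h
  have h' : (((univ.erase i₀).card + 1 : ℕ) : ℝ) = K + 1 := by rw [h]; exact hK
  push_cast at h'
  linarith

/-- From `K γ ≥ K + 1` with `K = #(univ.erase i₀) ≥ 0`: `K > 0` and `γ > 1`. [folklore] -/
theorem K_pos_of {K γ : ℝ} (hK0 : 0 ≤ K) (hγK : K + 1 ≤ K * γ) : 0 < K ∧ 1 < γ := by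
  constructor
  · by_contra h
    push Not at h
    have : K = 0 := le_antisymm h hK0
    rw [this] at hγK; linarith
  · by_contra h
    push Not at h
    nlinarith

/-- **THE QUADRATIC LEMMA («why `c*_m`», x-form).**  Let `x_t ≥ 0` (`t : ι`, `#ι = K + 1`), `y ≥ 0`, and let the exponent `γ`
satisfy `K γ ≥ K + 1` and `K γ² − 3 K γ + K + 1 ≥ 0`.  If the non-`i₀` values satisfy `Σ_{t ≠ i₀} x_t ≤ y` (the BHK bound
`σ ≤ 1`) and `Σ_t x_t > γ·y` (the deficit is decreasing), then `Σ_t x_t² > γ·y²` (the slope is increasing).  Proof: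
`K·Σ_{t≠i₀} x_t² ≥ s²` (`s = Σ_{t≠i₀} x_t`, Cauchy–Schwarz), `x_{i₀} > γy − s ≥ 0`, and
`K(γy − s)² + s² − Kγy² = (y − s)((2Kγ − K − 1)y − (K+1)s) + (Kγ² − 3Kγ + K + 1)y² ≥ 0` for `0 ≤ s ≤ y`. [folklore] -/
theorem quad_gen {K : ℝ} (hK : (Fintype.card ι : ℝ) = K + 1) (i₀ : ι) (x : ι → ℝ) (y γ : ℝ) (hx : ∀ t, 0 ≤ x t)
    (hy : 0 ≤ y) (hγK : K + 1 ≤ K * γ) (hγq : 0 ≤ K * γ ^ 2 - 3 * K * γ + K + 1)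
    (hσ : ∑ t ∈ univ.erase i₀, x t ≤ y) (hD : γ * y < ∑ t, x t) :
    γ * y ^ 2 < ∑ t, x t ^ 2 := by
  have hKc := card_erase_eq hK i₀
  have hK0 : 0 ≤ K := by rw [← hKc]; exact Nat.cast_nonneg _
  obtain ⟨hKpos, hγ1⟩ := K_pos_of hK0 hγK
  set s := ∑ t ∈ univ.erase i₀, x t with hs
  have hs0 : 0 ≤ s := Finset.sum_nonneg fun t _ => hx t
  have hcs : s ^ 2 ≤ K * ∑ t ∈ univ.erase i₀, x t ^ 2 := by
    rw [← hKc]; exact sq_sum_le_card_mul_sum_sq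
  rw [sum_split x i₀] at hD
  rw [sum_split (fun t => x t ^ 2) i₀]
  have h0 : γ * y - s < x i₀ := by linarith
  have h0' : 0 ≤ γ * y - s := by nlinarith
  have hx0 : 0 ≤ x i₀ := hx i₀
  have hsq : (γ * y - s) ^ 2 < x i₀ ^ 2 := by nlinarith [mul_lt_mul'' h0 h0 h0' h0']
  have hfac : 0 ≤ (2 * K * γ - K - 1) * y - (K + 1) * s := by
    nlinarith [mul_nonneg (by linarith : (0:ℝ) ≤ K + 1) (sub_nonneg.2 hσ),
      mul_nonneg (by linarith : (0:ℝ) ≤ K * γ - K - 1) hy]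
  have hpoly : K * γ * y ^ 2 ≤ K * (γ * y - s) ^ 2 + s ^ 2 := by
    nlinarith [mul_nonneg (sub_nonneg.2 hσ) hfac, mul_nonneg hγq (sq_nonneg y)]
  have key : K * (γ * y ^ 2) < K * (x i₀ ^ 2 + ∑ t ∈ univ.erase i₀, x t ^ 2) := by
    nlinarith [mul_lt_mul_of_pos_left hsq hKpos]
  exact lt_of_mul_lt_mul_left key hKpos.le

/-! ### The line: definitions and derivatives -/

/-! Notation of the docstrings (the statements spell the functions out, so that the file declares no definitions):
`F(w) := Σ_t log (a_t − w b_t) − γ·log (A − w B)` (the ISO deficit along the line, `r_t(w) = a_t − w b_t`, `u(w) = A − w B`),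
`g(w) := Σ_t b_t/(a_t − w b_t) − γ·B/(A − w B)` (`= −F′(w)`),
`g′(w) := Σ_t (b_t/(a_t − w b_t))² − γ·(B/(A − w B))²` (`= dg/dw`). -/

variable {a b : ι → ℝ} {A B γ : ℝ}

omit [Fintype ι] [DecidableEq ι] in
/-- Positivity of the affine functions `r_t(w) = a_t − w b_t` for `w ≤ 1`. [folklore] -/
theorem pos_t (hb : ∀ t, 0 ≤ b t) (hab : ∀ t, b t < a t) (t : ι) {w : ℝ} (hw : w ≤ 1) :
    0 < a t - w * b t := by
  have := hab t
  nlinarith [hb t]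

/-! Positivity of `u(w) = A − w B` for `w ≤ 1` is `IsoFiveLine.pos` (landed). -/

omit [DecidableEq ι] in
/-- `F` has derivative `−g` at every `w ≤ 1`. -/
theorem hasDerivAt_F (hb : ∀ t, 0 ≤ b t) (hab : ∀ t, b t < a t) (hB : 0 ≤ B) (hAB : B < A) {w : ℝ} (hw : w ≤ 1) :
    HasDerivAt ((fun w : ℝ => ∑ t, Real.log (a t - w * b t) - γ * Real.log (A - w * B)))
      (-((fun w : ℝ => ∑ t, b t / (a t - w * b t) - γ * (B / (A - w * B))) w)) w := by
  have hlin : ∀ c d : ℝ, HasDerivAt (fun w : ℝ => c - w * d) (-(1 * d)) w := fun c d =>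
    ((hasDerivAt_id' w).mul_const d).const_sub c
  have hsum : HasDerivAt (fun w => ∑ t, Real.log (a t - w * b t)) (∑ t, (-(1 * b t)) / (a t - w * b t)) w := by
    apply HasDerivAt.fun_sum
    intro t _
    exact (hlin (a t) (b t)).log (ne_of_gt (pos_t hb hab t hw))
  have hu : HasDerivAt (fun w => γ * Real.log (A - w * B)) (γ * ((-(1 * B)) / (A - w * B))) w :=
    ((hlin A B).log (ne_of_gt (IsoFiveLine.pos hB hAB hw))).const_mul _
  have key : HasDerivAt ((fun w : ℝ => ∑ t, Real.log (a t - w * b t) - γ * Real.log (A - w * B)))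
      ((∑ t, (-(1 * b t)) / (a t - w * b t)) - γ * ((-(1 * B)) / (A - w * B))) w := hsum.fun_sub hu
  refine key.congr_deriv ?_
  simp only [one_mul, neg_div, Finset.sum_neg_distrib]
  ring

omit [DecidableEq ι] in
/-- `g` has derivative `g'` at every `w ≤ 1`. -/
theorem hasDerivAt_g (hb : ∀ t, 0 ≤ b t) (hab : ∀ t, b t < a t) (hB : 0 ≤ B) (hAB : B < A) {w : ℝ} (hw : w ≤ 1) :
    HasDerivAt ((fun w : ℝ => ∑ t, b t / (a t - w * b t) - γ * (B / (A - w * B))))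
      ((fun w : ℝ => ∑ t, (b t / (a t - w * b t)) ^ 2 - γ * (B / (A - w * B)) ^ 2) w) w := by
  have hlin : ∀ c d : ℝ, HasDerivAt (fun w : ℝ => c - w * d) (-(1 * d)) w := fun c d =>
    ((hasDerivAt_id' w).mul_const d).const_sub c
  have hquot : ∀ c d : ℝ, 0 < c - w * d →
      HasDerivAt (fun w : ℝ => d / (c - w * d)) ((d / (c - w * d)) ^ 2) w := by
    intro c d hcd
    have := (hasDerivAt_const w d).div (hlin c d) (ne_of_gt hcd)
    refine this.congr_deriv ?_
    rw [div_pow]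
    ring
  have hsum : HasDerivAt (fun w => ∑ t, b t / (a t - w * b t)) (∑ t, (b t / (a t - w * b t)) ^ 2) w := by
    apply HasDerivAt.fun_sum
    intro t _
    exact hquot (a t) (b t) (pos_t hb hab t hw)
  have hu : HasDerivAt (fun w => γ * (B / (A - w * B))) (γ * (B / (A - w * B)) ^ 2) w :=
    (hquot A B (IsoFiveLine.pos hB hAB hw)).const_mul _
  exact hsum.fun_sub hu

omit [DecidableEq ι] in
/-- `F` is continuous on `[0,1]`. -/
theorem continuousOn_F (hb : ∀ t, 0 ≤ b t) (hab : ∀ t, b t < a t) (hB : 0 ≤ B) (hAB : B < A) :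
    ContinuousOn ((fun w : ℝ => ∑ t, Real.log (a t - w * b t) - γ * Real.log (A - w * B))) (Icc 0 1) :=
  fun _ hw => (hasDerivAt_F hb hab hB hAB hw.2).continuousAt.continuousWithinAt

omit [DecidableEq ι] in
/-- `g` is continuous on `[0,1]`. -/
theorem continuousOn_g (hb : ∀ t, 0 ≤ b t) (hab : ∀ t, b t < a t) (hB : 0 ≤ B) (hAB : B < A) :
    ContinuousOn ((fun w : ℝ => ∑ t, b t / (a t - w * b t) - γ * (B / (A - w * B)))) (Icc 0 1) :=
  fun _ hw => (hasDerivAt_g hb hab hB hAB hw.2).continuousAt.continuousWithinAt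

/-! ### The up-set argument and unimodality -/

/-! The BHK hypothesis along the line (slope form), written out in every statement as `hσ`:
for every `w ∈ [0,1)`, `Σ_{t ≠ i₀} b_t/(a_t − w b_t) ≤ B/(A − w B)`.  The exponent hypotheses: `#ι = K + 1`, `K γ ≥ K + 1`,
`K γ² − 3 K γ + K + 1 ≥ 0`. -/

/-- Where the deficit is decreasing (`g > 0`) its slope is increasing (`g' > 0`): the quadratic lemma applied to
`x_t = b_t/(a_t − w b_t)`, `y = B/(A − w B)`. -/
theorem g'_pos_of_g_pos {K : ℝ} (hK : (Fintype.card ι : ℝ) = K + 1) (i₀ : ι) (hγK : K + 1 ≤ K * γ)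
    (hγq : 0 ≤ K * γ ^ 2 - 3 * K * γ + K + 1)
    (hb : ∀ t, 0 ≤ b t) (hab : ∀ t, b t < a t) (hB : 0 ≤ B) (hAB : B < A)
    (hσ : ∀ w ∈ Ico (0 : ℝ) 1, ∑ t ∈ univ.erase i₀, b t / (a t - w * b t) ≤ B / (A - w * B)) {w : ℝ} (hw : w ∈ Ico (0 : ℝ) 1)
    (hg : 0 < (fun w : ℝ => ∑ t, b t / (a t - w * b t) - γ * (B / (A - w * B))) w) :
    0 < (fun w : ℝ => ∑ t, (b t / (a t - w * b t)) ^ 2 - γ * (B / (A - w * B)) ^ 2) w := by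
  have hw1 : w ≤ 1 := le_of_lt hw.2
  set x : ι → ℝ := fun t => b t / (a t - w * b t) with hx
  set y : ℝ := B / (A - w * B) with hy
  have hx0 : ∀ t, 0 ≤ x t := fun t => div_nonneg (hb t) (le_of_lt (pos_t hb hab t hw1))
  have hy0 : 0 ≤ y := div_nonneg hB (le_of_lt (IsoFiveLine.pos hB hAB hw1))
  have hσ' : ∑ t ∈ univ.erase i₀, x t ≤ y := hσ w hw
  have hD : γ * y < ∑ t, x t := by
    have : (fun w : ℝ => ∑ t, b t / (a t - w * b t) - γ * (B / (A - w * B))) w = ∑ t, x t - γ * y := rfl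
    linarith
  have key := quad_gen hK i₀ x y γ hx0 hy0 hγK hγq hσ' hD
  have : (fun w : ℝ => ∑ t, (b t / (a t - w * b t)) ^ 2 - γ * (B / (A - w * B)) ^ 2) w = ∑ t, x t ^ 2 - γ * y ^ 2 := rfl
  linarith

/-- **The up-set lemma.**  If the deficit is strictly decreasing at some `w₀ ∈ [0,1)` (`g(w₀) > 0`), it stays so on `[w₀, 1]`. -/
theorem g_ge_of_g_pos {K : ℝ} (hK : (Fintype.card ι : ℝ) = K + 1) (i₀ : ι) (hγK : K + 1 ≤ K * γ)
    (hγq : 0 ≤ K * γ ^ 2 - 3 * K * γ + K + 1)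
    (hb : ∀ t, 0 ≤ b t) (hab : ∀ t, b t < a t) (hB : 0 ≤ B) (hAB : B < A)
    (hσ : ∀ w ∈ Ico (0 : ℝ) 1, ∑ t ∈ univ.erase i₀, b t / (a t - w * b t) ≤ B / (A - w * B)) {w₀ : ℝ}
    (hw₀ : w₀ ∈ Ico (0 : ℝ) 1) (hg : 0 < (fun w : ℝ => ∑ t, b t / (a t - w * b t) - γ * (B / (A - w * B))) w₀) :
    ∀ w ∈ Icc w₀ 1, (fun w : ℝ => ∑ t, b t / (a t - w * b t) - γ * (B / (A - w * B))) w₀ ≤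
      (fun w : ℝ => ∑ t, b t / (a t - w * b t) - γ * (B / (A - w * B))) w := by
  intro w hw
  have hcont : ContinuousOn ((fun w : ℝ => ∑ t, b t / (a t - w * b t) - γ * (B / (A - w * B)))) (Icc w₀ 1) :=
    (continuousOn_g hb hab hB hAB).mono (Icc_subset_Icc hw₀.1 le_rfl)
  refine image_le_of_deriv_right_lt_deriv_boundary'
    (f := fun _ => (fun w : ℝ => ∑ t, b t / (a t - w * b t) - γ * (B / (A - w * B))) w₀) (f' := fun _ => 0)
    (B := (fun w : ℝ => ∑ t, b t / (a t - w * b t) - γ * (B / (A - w * B))))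
    (B' := (fun w : ℝ => ∑ t, (b t / (a t - w * b t)) ^ 2 - γ * (B / (A - w * B)) ^ 2)) continuousOn_const
    (fun x _ => (hasDerivAt_const x _).hasDerivWithinAt) le_rfl hcont
    (fun x hx => (hasDerivAt_g hb hab hB hAB (le_of_lt hx.2)).hasDerivWithinAt) ?_ hw
  intro x hx hfx
  have hx' : x ∈ Ico (0 : ℝ) 1 := ⟨hw₀.1.trans hx.1, hx.2⟩
  have : 0 < (fun w : ℝ => ∑ t, b t / (a t - w * b t) - γ * (B / (A - w * B))) x := by
    simp only at hfx ⊢; rw [← hfx]; exact hg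
  exact g'_pos_of_g_pos hK i₀ hγK hγq hb hab hB hAB hσ hx' this

/-- **Unimodality ⟹ (QC_e) for a marked–Steiner edge.**  Under the BHK hypothesis `hσ`, the ISO deficit along the line satisfies
`F(w) ≥ min (F 0) (F 1)` for every `w ∈ [0,1]`. -/
theorem F_ge_min {K : ℝ} (hK : (Fintype.card ι : ℝ) = K + 1) (i₀ : ι) (hγK : K + 1 ≤ K * γ)
    (hγq : 0 ≤ K * γ ^ 2 - 3 * K * γ + K + 1)
    (hb : ∀ t, 0 ≤ b t) (hab : ∀ t, b t < a t) (hB : 0 ≤ B) (hAB : B < A)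
    (hσ : ∀ w ∈ Ico (0 : ℝ) 1, ∑ t ∈ univ.erase i₀, b t / (a t - w * b t) ≤ B / (A - w * B)) {w : ℝ} (hw : w ∈ Icc (0 : ℝ) 1) :
    min ((fun w : ℝ => ∑ t, Real.log (a t - w * b t) - γ * Real.log (A - w * B)) 0)
        ((fun w : ℝ => ∑ t, Real.log (a t - w * b t) - γ * Real.log (A - w * B)) 1) ≤
      (fun w : ℝ => ∑ t, Real.log (a t - w * b t) - γ * Real.log (A - w * B)) w := by
  by_cases hcase : ∃ w₀ ∈ Ico (0 : ℝ) w, 0 < (fun w : ℝ => ∑ t, b t / (a t - w * b t) - γ * (B / (A - w * B))) w₀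
  · obtain ⟨w₀, hw₀, hg⟩ := hcase
    have hw₀' : w₀ ∈ Ico (0 : ℝ) 1 := ⟨hw₀.1, lt_of_lt_of_le hw₀.2 hw.2⟩
    have hanti : AntitoneOn ((fun w : ℝ => ∑ t, Real.log (a t - w * b t) - γ * Real.log (A - w * B))) (Icc w 1) := by
      apply antitoneOn_of_hasDerivWithinAt_nonpos (convex_Icc w 1)
        ((continuousOn_F hb hab hB hAB).mono (Icc_subset_Icc hw.1 le_rfl))
        (f' := fun x => -((fun w : ℝ => ∑ t, b t / (a t - w * b t) - γ * (B / (A - w * B))) x))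
      · intro x hx
        rw [interior_Icc] at hx
        exact (hasDerivAt_F hb hab hB hAB (le_of_lt hx.2)).hasDerivWithinAt
      · intro x hx
        rw [interior_Icc] at hx
        have := g_ge_of_g_pos hK i₀ hγK hγq hb hab hB hAB hσ hw₀' hg x ⟨le_of_lt (lt_trans hw₀.2 hx.1), le_of_lt hx.2⟩
        linarith
    have := hanti ⟨le_rfl, hw.2⟩ ⟨hw.2, le_rfl⟩ hw.2
    exact le_trans (min_le_right _ _) this
  · push Not at hcase
    have hmono : MonotoneOn ((fun w : ℝ => ∑ t, Real.log (a t - w * b t) - γ * Real.log (A - w * B))) (Icc 0 w) := by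
      apply monotoneOn_of_hasDerivWithinAt_nonneg (convex_Icc 0 w)
        ((continuousOn_F hb hab hB hAB).mono (Icc_subset_Icc le_rfl hw.2))
        (f' := fun x => -((fun w : ℝ => ∑ t, b t / (a t - w * b t) - γ * (B / (A - w * B))) x))
      · intro x hx
        rw [interior_Icc] at hx
        exact (hasDerivAt_F hb hab hB hAB (le_trans (le_of_lt hx.2) hw.2)).hasDerivWithinAt
      · intro x hx
        rw [interior_Icc] at hx
        have := hcase x ⟨le_of_lt hx.1, hx.2⟩
        linarith
    have := hmono ⟨le_rfl, hw.1⟩ ⟨hw.1, le_rfl⟩ hw.1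
    exact le_trans (min_le_left _ _) this

/-! ### The multiplicative corollary: (ISO_m) propagates from the end points to the whole line -/

omit [DecidableEq ι] in
/-- `F(w) ≥ 0` is `(ISO_m)` at `w`: `u(w)^γ ≤ ∏_t r_t(w)` (real power). -/
theorem F_nonneg_iff (hb : ∀ t, 0 ≤ b t) (hab : ∀ t, b t < a t) (hB : 0 ≤ B) (hAB : B < A) {w : ℝ} (hw : w ≤ 1) :
    0 ≤ (fun w : ℝ => ∑ t, Real.log (a t - w * b t) - γ * Real.log (A - w * B)) w ↔
      (A - w * B) ^ γ ≤ ∏ t, (a t - w * b t) := by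
  have hu : 0 < A - w * B := IsoFiveLine.pos hB hAB hw
  have hr : ∀ t, 0 < a t - w * b t := fun t => pos_t hb hab t hw
  have hprod : 0 < ∏ t, (a t - w * b t) := Finset.prod_pos fun t _ => hr t
  rw [← Real.log_le_log_iff (Real.rpow_pos_of_pos hu γ) hprod, Real.log_rpow hu,
    Real.log_prod (s := Finset.univ) (f := fun t => a t - w * b t) (fun t _ => ne_of_gt (hr t))]
  constructor
  · intro hF; simp only at hF; linarith
  · intro hF; simp only; linarith

/-- **(ISO_m) along a marked–Steiner line.**  If `u^γ ≤ ∏ r_t` holds for the edge deleted (`w = 0`: `A^γ ≤ ∏ a_t`) and for the edge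
contracted (`w = 1`: `(A − B)^γ ≤ ∏ (a_t − b_t)`), and the BHK bound `hσ` holds along the line, then `(A − w B)^γ ≤ ∏_t (a_t − w b_t)`
for every `w ∈ [0,1]`. -/
theorem iso_line {K : ℝ} (hK : (Fintype.card ι : ℝ) = K + 1) (i₀ : ι) (hγK : K + 1 ≤ K * γ)
    (hγq : 0 ≤ K * γ ^ 2 - 3 * K * γ + K + 1)
    (hb : ∀ t, 0 ≤ b t) (hab : ∀ t, b t < a t) (hB : 0 ≤ B) (hAB : B < A)
    (hσ : ∀ w ∈ Ico (0 : ℝ) 1, ∑ t ∈ univ.erase i₀, b t / (a t - w * b t) ≤ B / (A - w * B))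
    (h0 : A ^ γ ≤ ∏ t, a t) (h1 : (A - B) ^ γ ≤ ∏ t, (a t - b t))
    {w : ℝ} (hw : w ∈ Icc (0 : ℝ) 1) : (A - w * B) ^ γ ≤ ∏ t, (a t - w * b t) := by
  rw [← F_nonneg_iff hb hab hB hAB hw.2]
  have hF0 : 0 ≤ (fun w : ℝ => ∑ t, Real.log (a t - w * b t) - γ * Real.log (A - w * B)) 0 := by
    rw [F_nonneg_iff hb hab hB hAB zero_le_one]
    simpa using h0
  have hF1 : 0 ≤ (fun w : ℝ => ∑ t, Real.log (a t - w * b t) - γ * Real.log (A - w * B)) 1 := by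
    rw [F_nonneg_iff hb hab hB hAB le_rfl]
    simpa using h1
  exact le_trans (le_min hF0 hF1) (F_ge_min hK i₀ hγK hγq hb hab hB hAB hσ hw)

end IsoPtsLine
end Refresh
end HubOnly
end Summit.CriticalPhenomena.PercolationContinuityZ3.Theorems
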